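import Literature.NumberTheory.Transcendental.KZIdealTetrahedron
import Literature.NumberTheory.Transcendental.KZLogCalculusProofs
import Summits.KontsevichZagierPeriods.KontsevichZagierPeriods.Theorems.HyperbolicBlochIsometryMove

/-!
# `FiveTermTransfer` (stmt-KontsevichZagierPeriods-3469) — line `valuation-kernel-sweep`,
stub `stub_prismClass`

For a standard family `ρ` (on the algebraic upper half plane `ρ z` is a representation
`[T(z), t⁻³]` on the ideal tetrahedron `T(z) = idealTetrahedron z`), its signed class map `B`
(`[ρ z]` on the upper half plane, `−[ρ z̄]` on the lower half plane, `0` on the real line) and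
algebraic `a ≠ 0`, `b`, `w`, the signed class `B w` is, modulo relations of the Kontsevich–Zagier
calculus, `sg w • [R]` for a representation `R = [P, t⁻³]` on the prism `P = P b (a + b) (a w + b)`
over the triangle `(b, a + b, a w + b)` above its circumhemisphere.

Proof: the boundary-fixing similarity `Φ : (z, t) ↦ (a z + b, ‖a‖ t)` of the upper half space
(`z = p₀ + i η p₁`, `η = 1` for `Im w > 0`, the mirror `η = −1` applied to `T(w̄)` for `Im w < 0`)
is ONE change-of-variables move of the calculus (`simil_transport` of the sibling crux
`IsometryMove`: `ℚ`-semialgebraic, injective, `|det DΦ| = ‖a‖³` absorbed by `t⁻³`), and it carries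
`T(w)` (resp. `T(w̄)`) onto `P`: at `q = Φ p` the three edge forms and the circumsphere form of `P`
are `normSq a` (resp. `normSq a ^ 2`) times the corresponding defining forms of the ideal
tetrahedron, and the orientation factor is `normSq a · Im w` (`prismClass_forms`). For real `w`
that factor vanishes, `P = ∅`, and both sides are `0`. [folklore]
-/

noncomputable section

open MeasureTheory Set Complex
open scoped ComplexConjugate

namespace Summit.KontsevichZagierPeriods.HyperbolicBloch.FiveTerm

open Literature.NumberTheory.Transcendental
open Literature.NumberTheory.Transcendental.KZ
open Literature.ModelTheory.ExponentialFields (IsSemialgebraic isSemialgebraic_empty)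
open Summit.KontsevichZagierPeriods.HyperbolicBloch.IsometryMove (simil_transport)

/-- The orientation factor of the prism over `(b, a + b, a w + b)`: twice the signed area of the
triangle, `L b (a + b) (a w + b) = normSq a · Im w`. [folklore] -/
theorem prismClass_area (L : ℂ → ℂ → (Fin 3 → ℝ) → ℝ)
    (hL : ∀ u v p, L u v p = (v.re - u.re) * (p 1 - u.im) - (v.im - u.im) * (p 0 - u.re))
    (a b w : ℂ) :
    L b (a + b) ![(a * w + b).re, (a * w + b).im, 0] = Complex.normSq a * w.im := by
  rw [hL]
  simp only [Matrix.cons_val_zero, Matrix.cons_val_one, Complex.add_re, Complex.add_im,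
    Complex.mul_re, Complex.mul_im, Complex.normSq_apply]
  ring

/-- The three edge forms and the circumsphere form of the prism over `(b, a + b, a w + b)` at the
image `q = (a z + b, ‖a‖ t)`, `z = p₀ + i η p₁` (`η = ±1`), of a point `p`: they are `normSq a`
(resp. `normSq a ^ 2`) times the defining forms of the ideal tetrahedron `T(w)` read at
`(p₀, η p₁, p₂)`. Pure polynomial identities. [folklore] -/
theorem prismClass_forms (L : ℂ → ℂ → (Fin 3 → ℝ) → ℝ)
    (hL : ∀ u v p, L u v p = (v.re - u.re) * (p 1 - u.im) - (v.im - u.im) * (p 0 - u.re))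
    (S : ℂ → ℂ → ℂ → (Fin 3 → ℝ) → ℝ)
    (hS : ∀ u v w p, S u v w p = (p 0 ^ 2 + p 1 ^ 2 + p 2 ^ 2) * (u.re * (v.im - w.im) - u.im * (v.re - w.re) + (v.re * w.im - v.im * w.re)) - p 0 * (Complex.normSq u * (v.im - w.im) - u.im * (Complex.normSq v - Complex.normSq w) + (Complex.normSq v * w.im - v.im * Complex.normSq w)) + p 1 * (Complex.normSq u * (v.re - w.re) - u.re * (Complex.normSq v - Complex.normSq w) + (Complex.normSq v * w.re - v.re * Complex.normSq w)) - (Complex.normSq u * (v.re * w.im - v.im * w.re) - u.re * (Complex.normSq v * w.im - v.im * Complex.normSq w) + u.im * (Complex.normSq v * w.re - v.re * Complex.normSq w)))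
    (a b w : ℂ) {η : ℝ} (hη : η = 1 ∨ η = -1) (Φ : (Fin 3 → ℝ) → (Fin 3 → ℝ))
    (hΦ : ∀ p, Φ p = ![(a * (Complex.mk (p 0) (η * p 1)) + b).re,
      (a * (Complex.mk (p 0) (η * p 1)) + b).im, ‖a‖ * p 2])
    (p : Fin 3 → ℝ) :
    L b (a + b) (Φ p) = Complex.normSq a * (η * p 1) ∧
    L (a + b) (a * w + b) (Φ p) = Complex.normSq a * ((w.re - 1) * (η * p 1) - w.im * (p 0 - 1)) ∧
    L (a * w + b) b (Φ p) = Complex.normSq a * (w.im * p 0 - w.re * (η * p 1)) ∧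
    S b (a + b) (a * w + b) (Φ p) = Complex.normSq a ^ 2 *
      (w.im * (p 0 ^ 2 + p 1 ^ 2 + p 2 ^ 2 - p 0) + (w.re - Complex.normSq w) * (η * p 1)) := by
  have hn : ‖a‖ ^ 2 = a.re * a.re + a.im * a.im := by rw [Complex.sq_norm, Complex.normSq_apply]
  refine ⟨?_, ?_, ?_, ?_⟩
  · rw [hL, hΦ]
    simp only [Matrix.cons_val_zero, Matrix.cons_val_one, Complex.add_re, Complex.add_im,
      Complex.mul_re, Complex.mul_im, Complex.normSq_apply]
    ring
  · rw [hL, hΦ]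
    simp only [Matrix.cons_val_zero, Matrix.cons_val_one, Complex.add_re, Complex.add_im,
      Complex.mul_re, Complex.mul_im, Complex.normSq_apply]
    ring
  · rw [hL, hΦ]
    simp only [Matrix.cons_val_zero, Matrix.cons_val_one, Complex.add_re, Complex.add_im,
      Complex.mul_re, Complex.mul_im, Complex.normSq_apply]
    ring
  · rw [hS, hΦ]
    simp only [Matrix.cons_val_zero, Matrix.cons_val_one, Matrix.head_cons, Matrix.cons_val_two,
      Matrix.tail_cons, Complex.add_re, Complex.add_im, Complex.mul_re, Complex.mul_im,
      Complex.normSq_apply]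
    rcases hη with rfl | rfl
    · linear_combination (p 2 ^ 2 * ((a.re * a.re + a.im * a.im) * w.im)) * hn
    · linear_combination (p 2 ^ 2 * ((a.re * a.re + a.im * a.im) * w.im)) * hn

/-- The similarity `Φ` carries the ideal tetrahedron `T(v)` (`Im v > 0`) pointwise onto the prism
over `(b, a + b, a w + b)`, `w = Re v + i η Im v`: `Φ p ∈ P b (a + b) (a w + b) ↔ p ∈ T(v)` (each
defining inequality of the prism at `Φ p` is a positive multiple of the corresponding one of
`T(v)` at `p`). [folklore] -/
theorem prismClass_mem_iff (L : ℂ → ℂ → (Fin 3 → ℝ) → ℝ)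
    (hL : ∀ u v p, L u v p = (v.re - u.re) * (p 1 - u.im) - (v.im - u.im) * (p 0 - u.re))
    (S : ℂ → ℂ → ℂ → (Fin 3 → ℝ) → ℝ)
    (hS : ∀ u v w p, S u v w p = (p 0 ^ 2 + p 1 ^ 2 + p 2 ^ 2) * (u.re * (v.im - w.im) - u.im * (v.re - w.re) + (v.re * w.im - v.im * w.re)) - p 0 * (Complex.normSq u * (v.im - w.im) - u.im * (Complex.normSq v - Complex.normSq w) + (Complex.normSq v * w.im - v.im * Complex.normSq w)) + p 1 * (Complex.normSq u * (v.re - w.re) - u.re * (Complex.normSq v - Complex.normSq w) + (Complex.normSq v * w.re - v.re * Complex.normSq w)) - (Complex.normSq u * (v.re * w.im - v.im * w.re) - u.re * (Complex.normSq v * w.im - v.im * Complex.normSq w) + u.im * (Complex.normSq v * w.re - v.re * Complex.normSq w)))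
    (P : ℂ → ℂ → ℂ → Set (Fin 3 → ℝ))
    (hP : ∀ u v w, P u v w = {p | 0 < p 2 ∧ 0 < L u v ![w.re, w.im, 0] * L u v p ∧ 0 < L u v ![w.re, w.im, 0] * L v w p ∧ 0 < L u v ![w.re, w.im, 0] * L w u p ∧ 0 < L u v ![w.re, w.im, 0] * S u v w p})
    {a b : ℂ} (ha : a ≠ 0) (v w : ℂ) (η : ℝ) (hη : η = 1 ∨ η = -1) (hv : 0 < v.im)
    (hre : w.re = v.re) (him : w.im = η * v.im) (Φ : (Fin 3 → ℝ) → (Fin 3 → ℝ))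
    (hΦ : ∀ p, Φ p = ![(a * (Complex.mk (p 0) (η * p 1)) + b).re,
      (a * (Complex.mk (p 0) (η * p 1)) + b).im, ‖a‖ * p 2])
    (p : Fin 3 → ℝ) : Φ p ∈ P b (a + b) (a * w + b) ↔ p ∈ idealTetrahedron v := by
  obtain ⟨h1, h2, h3, h5⟩ := prismClass_forms L hL S hS a b w hη Φ hΦ p
  have hJ := prismClass_area L hL a b w
  have hN : 0 < Complex.normSq a := Complex.normSq_pos.mpr ha
  have hη2 : η * η = 1 := by rcases hη with rfl | rfl <;> norm_num
  have hnw : Complex.normSq w = Complex.normSq v := by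
    rw [Complex.normSq_apply, Complex.normSq_apply, hre, him]
    linear_combination (v.im * v.im) * hη2
  have hc : 0 < Complex.normSq a ^ 2 * v.im := by positivity
  have hc3 : 0 < Complex.normSq a ^ 3 * v.im := by positivity
  have e0 : Φ p 2 = ‖a‖ * p 2 := by
    simp only [hΦ, Matrix.cons_val_two, Matrix.tail_cons, Matrix.head_cons]
  have e1 : L b (a + b) ![(a * w + b).re, (a * w + b).im, 0] * L b (a + b) (Φ p) =
      Complex.normSq a ^ 2 * v.im * p 1 := by
    rw [hJ, h1, him]
    linear_combination (Complex.normSq a ^ 2 * v.im * p 1) * hη2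
  have e2 : L b (a + b) ![(a * w + b).re, (a * w + b).im, 0] * L (a + b) (a * w + b) (Φ p) =
      Complex.normSq a ^ 2 * v.im * ((v.re - 1) * p 1 - v.im * (p 0 - 1)) := by
    rw [hJ, h2, him, hre]
    linear_combination (Complex.normSq a ^ 2 * v.im * ((v.re - 1) * p 1 - v.im * (p 0 - 1))) * hη2
  have e3 : L b (a + b) ![(a * w + b).re, (a * w + b).im, 0] * L (a * w + b) b (Φ p) =
      Complex.normSq a ^ 2 * v.im * (v.im * p 0 - v.re * p 1) := by
    rw [hJ, h3, him, hre]
    linear_combination (Complex.normSq a ^ 2 * v.im * (v.im * p 0 - v.re * p 1)) * hη2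
  have e5 : L b (a + b) ![(a * w + b).re, (a * w + b).im, 0] * S b (a + b) (a * w + b) (Φ p) =
      Complex.normSq a ^ 3 * v.im *
        (v.im * (p 0 ^ 2 + p 1 ^ 2 + p 2 ^ 2 - p 0) + (v.re - Complex.normSq v) * p 1) := by
    rw [hJ, h5, hnw, him, hre]
    linear_combination (Complex.normSq a ^ 3 * v.im *
      (v.im * (p 0 ^ 2 + p 1 ^ 2 + p 2 ^ 2 - p 0) + (v.re - Complex.normSq v) * p 1)) * hη2
  rw [hP, Set.mem_setOf_eq, e0, e1, e2, e3, e5, mem_idealTetrahedron_iff,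
    mul_pos_iff_of_pos_left (norm_pos_iff.mpr ha), mul_pos_iff_of_pos_left hc,
    mul_pos_iff_of_pos_left hc, mul_pos_iff_of_pos_left hc, mul_pos_iff_of_pos_left hc3,
    sub_pos, sub_pos]
  constructor
  · rintro ⟨k1, k2, k3, k4, k5⟩
    exact ⟨k2, k4, k3, k1, k5⟩
  · rintro ⟨k1, k2, k3, k4, k5⟩
    exact ⟨k4, k1, k3, k2, k5⟩

/-- The similarity `Φ` maps the ideal tetrahedron `T(v)` ONTO the prism over
`(b, a + b, a w + b)`, `w = Re v + i η Im v` (the inverse point is `(a⁻¹ (q − b), q₂ / ‖a‖)`, read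
through the mirror `η`). [folklore] -/
theorem prismClass_image (L : ℂ → ℂ → (Fin 3 → ℝ) → ℝ)
    (hL : ∀ u v p, L u v p = (v.re - u.re) * (p 1 - u.im) - (v.im - u.im) * (p 0 - u.re))
    (S : ℂ → ℂ → ℂ → (Fin 3 → ℝ) → ℝ)
    (hS : ∀ u v w p, S u v w p = (p 0 ^ 2 + p 1 ^ 2 + p 2 ^ 2) * (u.re * (v.im - w.im) - u.im * (v.re - w.re) + (v.re * w.im - v.im * w.re)) - p 0 * (Complex.normSq u * (v.im - w.im) - u.im * (Complex.normSq v - Complex.normSq w) + (Complex.normSq v * w.im - v.im * Complex.normSq w)) + p 1 * (Complex.normSq u * (v.re - w.re) - u.re * (Complex.normSq v - Complex.normSq w) + (Complex.normSq v * w.re - v.re * Complex.normSq w)) - (Complex.normSq u * (v.re * w.im - v.im * w.re) - u.re * (Complex.normSq v * w.im - v.im * Complex.normSq w) + u.im * (Complex.normSq v * w.re - v.re * Complex.normSq w)))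
    (P : ℂ → ℂ → ℂ → Set (Fin 3 → ℝ))
    (hP : ∀ u v w, P u v w = {p | 0 < p 2 ∧ 0 < L u v ![w.re, w.im, 0] * L u v p ∧ 0 < L u v ![w.re, w.im, 0] * L v w p ∧ 0 < L u v ![w.re, w.im, 0] * L w u p ∧ 0 < L u v ![w.re, w.im, 0] * S u v w p})
    {a b : ℂ} (ha : a ≠ 0) (v w : ℂ) (η : ℝ) (hη : η = 1 ∨ η = -1) (hv : 0 < v.im)
    (hre : w.re = v.re) (him : w.im = η * v.im) (Φ : (Fin 3 → ℝ) → (Fin 3 → ℝ))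
    (hΦ : ∀ p, Φ p = ![(a * (Complex.mk (p 0) (η * p 1)) + b).re,
      (a * (Complex.mk (p 0) (η * p 1)) + b).im, ‖a‖ * p 2]) :
    Φ '' idealTetrahedron v = P b (a + b) (a * w + b) := by
  have hη2 : η * η = 1 := by rcases hη with rfl | rfl <;> norm_num
  apply Subset.antisymm
  · rintro _ ⟨p, hp, rfl⟩
    exact (prismClass_mem_iff L hL S hS P hP ha v w η hη hv hre him Φ hΦ p).2 hp
  · intro q hq
    obtain ⟨z, hz⟩ : ∃ z : ℂ, z = a⁻¹ * (Complex.mk (q 0) (q 1) - b) := ⟨_, rfl⟩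
    have hzz : (Complex.mk z.re (η * (η * z.im)) : ℂ) = z :=
      Complex.ext rfl (by show η * (η * z.im) = z.im; rw [← mul_assoc, hη2, one_mul])
    have haz : a * z + b = Complex.mk (q 0) (q 1) := by
      rw [hz, mul_inv_cancel_left₀ ha, sub_add_cancel]
    have hΦp : Φ ![z.re, η * z.im, q 2 / ‖a‖] = q := by
      rw [hΦ]
      simp only [Matrix.cons_val_zero, Matrix.cons_val_one, Matrix.head_cons, Matrix.cons_val_two,
        Matrix.tail_cons]
      rw [hzz, haz, mul_div_cancel₀ _ (norm_ne_zero_iff.mpr ha)]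
      ext i
      fin_cases i <;> rfl
    refine ⟨_, ?_, hΦp⟩
    exact (prismClass_mem_iff L hL S hS P hP ha v w η hη hv hre him Φ hΦ _).1 (by rw [hΦp]; exact hq)

/-- **The prism move.** For algebraic `a ≠ 0`, `b` and a representation `r = [T(v), t⁻³]`
(`Im v > 0`), there is a representation `R = [P b (a + b) (a w + b), t⁻³]`
(`w = Re v + i η Im v`, `η = ±1`) with `[r] − [R]` ONE change-of-variables move: the similarity
`(z, t) ↦ (a (p₀ + i η p₁) + b, ‖a‖ t)` (`simil_transport`: `ℚ`-semialgebraic, injective,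
`|det| = ‖a‖³ = (Φ₃ / t)³`). [folklore] -/
theorem prismClass_move (L : ℂ → ℂ → (Fin 3 → ℝ) → ℝ)
    (hL : ∀ u v p, L u v p = (v.re - u.re) * (p 1 - u.im) - (v.im - u.im) * (p 0 - u.re))
    (S : ℂ → ℂ → ℂ → (Fin 3 → ℝ) → ℝ)
    (hS : ∀ u v w p, S u v w p = (p 0 ^ 2 + p 1 ^ 2 + p 2 ^ 2) * (u.re * (v.im - w.im) - u.im * (v.re - w.re) + (v.re * w.im - v.im * w.re)) - p 0 * (Complex.normSq u * (v.im - w.im) - u.im * (Complex.normSq v - Complex.normSq w) + (Complex.normSq v * w.im - v.im * Complex.normSq w)) + p 1 * (Complex.normSq u * (v.re - w.re) - u.re * (Complex.normSq v - Complex.normSq w) + (Complex.normSq v * w.re - v.re * Complex.normSq w)) - (Complex.normSq u * (v.re * w.im - v.im * w.re) - u.re * (Complex.normSq v * w.im - v.im * Complex.normSq w) + u.im * (Complex.normSq v * w.re - v.re * Complex.normSq w)))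
    (P : ℂ → ℂ → ℂ → Set (Fin 3 → ℝ))
    (hP : ∀ u v w, P u v w = {p | 0 < p 2 ∧ 0 < L u v ![w.re, w.im, 0] * L u v p ∧ 0 < L u v ![w.re, w.im, 0] * L v w p ∧ 0 < L u v ![w.re, w.im, 0] * L w u p ∧ 0 < L u v ![w.re, w.im, 0] * S u v w p})
    {a b : ℂ} (ha : IsAlgebraic ℚ a) (hb : IsAlgebraic ℚ b) (ha0 : a ≠ 0) (v w : ℂ) (η : ℝ)
    (hη : η = 1 ∨ η = -1) (hv : 0 < v.im) (hre : w.re = v.re) (him : w.im = η * v.im)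
    (r : KZ.IntegralRep 3) (hdom : r.domain = idealTetrahedron v)
    (hint : EqOn r.integrand (fun p => 1 / p 2 ^ 3) r.domain) :
    ∃ R : KZ.IntegralRep 3, R.domain = P b (a + b) (a * w + b) ∧
      EqOn R.integrand (fun p => 1 / p 2 ^ 3) R.domain ∧ KZ.of r - KZ.of R ∈ KZ.relations := by
  obtain ⟨Φ, hΦ⟩ : ∃ Φ : (Fin 3 → ℝ) → (Fin 3 → ℝ), ∀ p, Φ p =
      ![(a * (Complex.mk (p 0) (η * p 1)) + b).re, (a * (Complex.mk (p 0) (η * p 1)) + b).im,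
        ‖a‖ * p 2] := ⟨_, fun _ => rfl⟩
  have hσ : r.domain ⊆ {p | 0 < p 2} := by
    rw [hdom]
    exact fun p hp => pos_of_mem_idealTetrahedron hp
  obtain ⟨⟨R, hRdom, hRint⟩, hmove⟩ := simil_transport ha hb ha0 hη Φ hΦ r hσ hint
  refine ⟨R, ?_, hRint, hmove R hRdom hRint⟩
  rw [hRdom, hdom]
  exact prismClass_image L hL S hS P hP ha0 v w η hη hv hre him Φ hΦ

/-- **Prism move** (stub `stub_prismClass` of line `valuation-kernel-sweep`). For algebraic
`a ≠ 0`, `b`, `w`, the signed class `B w` is, modulo relations, `sg w • [R]` for a representation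
`R` with integrand `t⁻³` on the prism over the triangle `(b, a + b, a w + b)` (the affine
similarity `z ↦ a z + b`, `t ↦ |a| t` of `ℍ³`, composed with the reflection
`(p₀,p₁,p₂) ↦ (p₀,−p₁,p₂)` when `Im w < 0`, is one change-of-variables move with `|det| = |a|³`;
for real `w` both sides vanish, the prism being empty). [folklore] -/
theorem stub_prismClass :
    ∀ (L : ℂ → ℂ → (Fin 3 → ℝ) → ℝ),
      (∀ u v p, L u v p = (v.re - u.re) * (p 1 - u.im) - (v.im - u.im) * (p 0 - u.re)) →
    ∀ (S : ℂ → ℂ → ℂ → (Fin 3 → ℝ) → ℝ),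
      (∀ u v w p, S u v w p = (p 0 ^ 2 + p 1 ^ 2 + p 2 ^ 2) * (u.re * (v.im - w.im) - u.im * (v.re - w.re) + (v.re * w.im - v.im * w.re)) - p 0 * (Complex.normSq u * (v.im - w.im) - u.im * (Complex.normSq v - Complex.normSq w) + (Complex.normSq v * w.im - v.im * Complex.normSq w)) + p 1 * (Complex.normSq u * (v.re - w.re) - u.re * (Complex.normSq v - Complex.normSq w) + (Complex.normSq v * w.re - v.re * Complex.normSq w)) - (Complex.normSq u * (v.re * w.im - v.im * w.re) - u.re * (Complex.normSq v * w.im - v.im * Complex.normSq w) + u.im * (Complex.normSq v * w.re - v.re * Complex.normSq w))) →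
    ∀ (P : ℂ → ℂ → ℂ → Set (Fin 3 → ℝ)),
      (∀ u v w, P u v w = {p | 0 < p 2 ∧ 0 < L u v ![w.re, w.im, 0] * L u v p ∧ 0 < L u v ![w.re, w.im, 0] * L v w p ∧ 0 < L u v ![w.re, w.im, 0] * L w u p ∧ 0 < L u v ![w.re, w.im, 0] * S u v w p}) →
    ∀ (ρ : ℂ → KZ.IntegralRep 3),
      (∀ z, IsAlgebraic ℚ z → 0 < z.im → (ρ z).domain = idealTetrahedron z ∧ Set.EqOn (ρ z).integrand (fun p => 1 / p 2 ^ 3) (idealTetrahedron z)) →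
    ∀ (B : ℂ → KZ.FormalRep),
      (∀ z, B z = if 0 < z.im then KZ.of (ρ z) else if z.im < 0 then -KZ.of (ρ ((starRingEnd ℂ) z)) else 0) →
    ∀ (sg : ℂ → ℤ), (∀ w, sg w = if 0 < w.im then 1 else if w.im < 0 then -1 else 0) →
    ∀ (a b w u₂ u₃ : ℂ), IsAlgebraic ℚ a → IsAlgebraic ℚ b → IsAlgebraic ℚ w → a ≠ 0 →
      u₂ = a + b → u₃ = a * w + b →
      ∃ R : KZ.IntegralRep 3, R.domain = P b u₂ u₃ ∧ Set.EqOn R.integrand (fun p => 1 / p 2 ^ 3) R.domain ∧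
        B w - sg w • KZ.of R ∈ KZ.relations := by
  intro L hL S hS P hP ρ hρ B hB sg hsg a b w u₂ u₃ ha hb hw ha0 hu₂ hu₃
  subst hu₂ hu₃
  rcases lt_trichotomy w.im 0 with hneg | hzero | hpos
  · -- lower half plane: mirror the tetrahedron `T(w̄)` (`η = -1`)
    have hwc : IsAlgebraic ℚ (conj w) := by simpa using hw.algHom (starRingEnd ℂ).toRatAlgHom
    have hvc : 0 < (conj w).im := by simpa using hneg
    obtain ⟨hd, hi⟩ := hρ (conj w) hwc hvc
    obtain ⟨R, hR1, hR2, hR3⟩ := prismClass_move L hL S hS P hP ha hb ha0 (conj w) w (-1)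
      (Or.inr rfl) hvc (by simp) (by simp) (ρ (conj w)) hd (by rw [hd]; exact hi)
    refine ⟨R, hR1, hR2, ?_⟩
    have hn' : ¬0 < w.im := not_lt.mpr hneg.le
    have hBw : B w = -KZ.of (ρ (conj w)) := by rw [hB, if_neg hn', if_pos hneg]
    have hsw : sg w = -1 := by rw [hsg, if_neg hn', if_pos hneg]
    have e : B w - sg w • KZ.of R = -(KZ.of (ρ (conj w)) - KZ.of R) := by
      rw [hBw, hsw, neg_one_zsmul]
      abel
    rw [e]
    exact neg_mem hR3
  · -- real line: the prism is empty, both sides vanish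
    have hempty : P b (a + b) (a * w + b) = ∅ := by
      rw [hP, Set.eq_empty_iff_forall_notMem]
      intro p hp
      rw [Set.mem_setOf_eq, prismClass_area L hL, hzero, mul_zero, zero_mul] at hp
      exact lt_irrefl 0 hp.2.1
    obtain ⟨R, hRd, hRi⟩ := KZ.exists_zeroRep (n := 3) (σ := P b (a + b) (a * w + b))
      (by rw [hempty]; exact isSemialgebraic_empty)
    refine ⟨R, hRd, ?_, ?_⟩
    · rw [hRd, hempty]
      exact fun _ h => h.elim
    · have hBw : B w = 0 := by simp [hB, hzero]
      have hsw : sg w = 0 := by simp [hsg, hzero]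
      rw [hBw, hsw, zero_zsmul, sub_zero]
      exact zero_mem _
  · -- upper half plane (`η = 1`)
    obtain ⟨hd, hi⟩ := hρ w hw hpos
    obtain ⟨R, hR1, hR2, hR3⟩ := prismClass_move L hL S hS P hP ha hb ha0 w w 1 (Or.inl rfl) hpos
      rfl (by simp) (ρ w) hd (by rw [hd]; exact hi)
    refine ⟨R, hR1, hR2, ?_⟩
    have hBw : B w = KZ.of (ρ w) := by simp [hB, hpos]
    have hsw : sg w = 1 := by simp [hsg, hpos]
    rw [hBw, hsw, one_zsmul]
    exact hR3

end Summit.KontsevichZagierPeriods.HyperbolicBloch.FiveTerm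

end
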